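import Mathlib
import Summits.NavierStokesRegularity.FluidComputer.SkewCutGalerkinFromSections

/-!
# Skew-cut certificate: the CLOSED-bracket twin of the end-to-end statement (no end-injectivity input)
(instab4 g6 — implementation 2 of the skew-cut X0 certifier, cell `ns-blowup`, 2026-08-26)

HONEST FRAMING (human ruling D-0035): nothing here is a claim about Navier–Stokes blow-up.
WHAT THIS IS NOT: not NS evidence. MODEL lane. `SkewCutGalerkinMaster.exists_smooth_eigenvector_Ioo`
(p443836) and `SkewCutGalerkinFromSections.exists_smooth_eigenvector_Ioo_of_sections` (p446013) take,
besides the Galerkin / section data of the certificate, the injectivity of `R_a`, `R_e` at the two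
bracket ends (SKEWCUT-CERT Thm 1′ (a)) and conclude with an eigenvalue in the OPEN bracket `(a, e)`.
The compactness step underneath (`SkewCutGalerkinPerturbation.exists_eigenpair_of_galerkin_brackets_diagonal`)
already yields the eigenvalue in the CLOSED bracket `[a, e]` WITHOUT that input. This file records the
two closed-bracket statements, with proofs copied from the open-bracket ones minus the last step:

* `exists_smooth_eigenvector_Icc` — operator form (twin of `SkewCutGalerkinMaster.exists_smooth_eigenvector_Ioo`);
* `exists_smooth_eigenvector_Icc_of_sections` — matrix form (twin of
  `SkewCutGalerkinFromSections.exists_smooth_eigenvector_Ioo_of_sections`): Schur data of the banded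
  first-order matrix `t`, section eigenpairs `(x_n, c_n)` with `x_n ∈ [a, e]`, normalisation and graph
  bound ⇒ a bounded `T` with matrix `t` and `λ ∈ [a, e]`, `‖v‖ = 1`, the eigen-equation in coordinates
  and `Σ_i w_i^{2s} |⟪b i, v⟫|² < ∞` for every `s`.

Use: the class-II ASSEMBLY (`AbcClassII*`, this seat) closes the X0 chain to
`Torus.IsLinNSEigenvalue` with `λ ∈ [x₁, x₂]` from the head-sign / shell / tail hypotheses alone; the
open bracket is then an add-on via `SkewCutGalerkinTailForm.not_eigenvalue_of_structure`.
Mathlib + the files named; no new definitions.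
-/

noncomputable section

namespace Summit.NavierStokesRegularity.FluidComputer.SkewCutGalerkinFromSectionsIcc

open Filter Topology Submodule
open scoped InnerProductSpace

variable {𝕜 H : Type*} [RCLike 𝕜] [NormedAddCommGroup H] [InnerProductSpace 𝕜 H] [CompleteSpace H]
variable {ι : Type*} (b : HilbertBasis ι 𝕜 H)

/-- **Closed-bracket twin of `SkewCutGalerkinMaster.exists_smooth_eigenvector_Ioo`**: the same
hypotheses WITHOUT the two end-injectivities give `λ ∈ [a, c]`, `‖v‖ = 1`, the eigen-equation in
coordinates and all weighted moments of the coefficients finite. -/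
theorem exists_smooth_eigenvector_Icc
    (ℓ : ι → ℝ) (x₀ : ℝ) (d : lp (fun _ : ι => 𝕜) ⊤) (hd : ∀ i, d i * ((x₀ : 𝕜) - (ℓ i : 𝕜)) = 1)
    (hd0 : Tendsto (fun i => ‖d i‖) cofinite (𝓝 0))
    (T : H →L[𝕜] H) (hT : ‖T‖ < 1) (nbr : ι → Finset ι)
    (hsymm : ∀ i j, j ∈ nbr i ↔ i ∈ nbr j) {W : ℕ} (hW : ∀ i, (nbr i).card ≤ W)
    (ht0 : ∀ i j, j ∉ nbr i → ⟪b i, T (b j)⟫_𝕜 = 0)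
    (wgt : ι → ℝ) (hw0 : ∀ i, 0 ≤ wgt i) (hwℓ : ∀ i, wgt i ^ 2 ≤ 1 + |ℓ i|)
    {K : ℝ} (hK : 0 ≤ K)
    (ha : ∀ i j, j ∈ nbr i → ‖⟪b i, T (b j)⟫_𝕜 * ((x₀ : 𝕜) - (ℓ j : 𝕜))‖ ≤ K * wgt j)
    {L : ℝ} (hLnn : 0 ≤ L) (hL : ∀ i j, j ∈ nbr i → wgt i ≤ L * wgt j)
    {M : ℝ} (hM : ∀ i, ‖d i‖ * wgt i ≤ M)
    (F : ℕ → Set ι) (hF : Monotone F) (hFex : ∀ i, ∃ n, i ∈ F n)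
    (u : ℕ → H) (hu : ∀ n, u n ∈ (span 𝕜 (b '' F n)).topologicalClosure)
    (hv1 : ∀ n, ‖b.diagonalCLM d (u n)‖ = 1) {C : ℝ} (hC : ∀ n, ‖u n‖ ≤ C)
    (xs : ℕ → ℝ) {a c : ℝ} (hxs : ∀ n, xs n ∈ Set.Icc a c)
    (hGal : ∀ n, (span 𝕜 (b '' F n)).topologicalClosure.starProjection
        ((x₀ : 𝕜) • b.diagonalCLM d (u n) - u n + T (u n)) = (xs n : 𝕜) • b.diagonalCLM d (u n)) :
    ∃ lam ∈ Set.Icc a c, ∃ v : H, ‖v‖ = 1 ∧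
      (∀ i, (ℓ i : 𝕜) * ⟪b i, v⟫_𝕜 +
          ∑ j ∈ nbr i, (⟪b i, T (b j)⟫_𝕜 * ((x₀ : 𝕜) - (ℓ j : 𝕜))) * ⟪b j, v⟫_𝕜 =
        (lam : 𝕜) * ⟪b i, v⟫_𝕜) ∧
      ∀ s : ℕ, Summable fun i => wgt i ^ (2 * s) * ‖⟪b i, v⟫_𝕜‖ ^ 2 := by
  set S₀ : H →L[𝕜] H := b.diagonalCLM d with hS₀
  -- Step 1: the eigenpair in resolvent coordinates, closed bracket
  obtain ⟨lam, hlam, w, hw1, hw, -⟩ :=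
    SkewCutGalerkinPerturbation.exists_eigenpair_of_galerkin_brackets_diagonal b d hd0 T hT F hF hFex
      u hu hv1 hC x₀ xs hxs hGal
  set v : H := S₀ w with hv
  -- Step 2: coordinates `v_i = d_i w_i`, `w_i = (x₀ - ℓ_i) v_i`
  have hvi : ∀ i, ⟪b i, v⟫_𝕜 = d i * ⟪b i, w⟫_𝕜 := fun i =>
    SkewCutGalerkinMaster.inner_basis_diagonalCLM b d w i
  have hwi : ∀ i, ⟪b i, w⟫_𝕜 = ((x₀ : 𝕜) - (ℓ i : 𝕜)) * ⟪b i, v⟫_𝕜 := fun i => by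
    rw [hvi, ← mul_assoc, mul_comm ((x₀ : 𝕜) - (ℓ i : 𝕜)), hd, one_mul]
  -- Step 3: the eigen-equation in coordinates
  have heig : ∀ i, (ℓ i : 𝕜) * ⟪b i, v⟫_𝕜 +
      ∑ j ∈ nbr i, (⟪b i, T (b j)⟫_𝕜 * ((x₀ : 𝕜) - (ℓ j : 𝕜))) * ⟪b j, v⟫_𝕜 =
        (lam : 𝕜) * ⟪b i, v⟫_𝕜 := by
    intro i
    have h := congrArg (fun z => ⟪b i, z⟫_𝕜) hw
    simp only [inner_add_right, inner_sub_right, inner_smul_right] at h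
    rw [SkewCutGalerkinMaster.inner_basis_map_eq_sum b T nbr ht0 w i, hwi i] at h
    have hsum : ∑ j ∈ nbr i, ⟪b i, T (b j)⟫_𝕜 * ⟪b j, w⟫_𝕜 =
        ∑ j ∈ nbr i, (⟪b i, T (b j)⟫_𝕜 * ((x₀ : 𝕜) - (ℓ j : 𝕜))) * ⟪b j, v⟫_𝕜 :=
      Finset.sum_congr rfl fun j _ => by rw [hwi j, mul_assoc]
    rw [hsum] at h
    rw [← h]
    ring
  -- Step 4: form-level energy of `v = S₀ w` is finite (`‖d_i‖ w_i ≤ M`)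
  have h1 : Summable fun i => wgt i ^ 2 * ‖⟪b i, v⟫_𝕜‖ ^ 2 := by
    have hpar : Summable fun i => ‖⟪b i, w⟫_𝕜‖ ^ 2 := by
      have h := (b.hasSum_inner_mul_inner w w).summable.norm
      refine h.congr fun i => ?_
      rw [norm_mul, ← inner_conj_symm, RCLike.norm_conj, sq]
    refine Summable.of_nonneg_of_le (fun i => mul_nonneg (sq_nonneg _) (sq_nonneg _)) (fun i => ?_)
      (hpar.mul_left (M ^ 2))
    rw [hvi, norm_mul, mul_pow, ← mul_assoc]
    refine mul_le_mul_of_nonneg_right ?_ (sq_nonneg _)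
    calc wgt i ^ 2 * ‖d i‖ ^ 2 = (‖d i‖ * wgt i) ^ 2 := by ring
      _ ≤ M ^ 2 := pow_le_pow_left₀ (mul_nonneg (norm_nonneg _) (hw0 i)) (hM i) 2
  -- Step 5: the bootstrap
  refine ⟨lam, hlam, v, hw1, heig, fun s => ?_⟩
  exact Literature.Analysis.OperatorTheory.FirstOrderBand.summable_weighted_of_eigen (e := b)
    (w := wgt) (ℓ := ℓ) (nbr := nbr) (a := fun i j => ⟪b i, T (b j)⟫_𝕜 * ((x₀ : 𝕜) - (ℓ j : 𝕜)))
    (f := v) (lam := (lam : 𝕜)) hw0 hwℓ hK ha hsymm hW hLnn hL heig h1 s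

/-- **Closed-bracket twin of `SkewCutGalerkinFromSections.exists_smooth_eigenvector_Ioo_of_sections`**
(matrix inputs, no end-injectivity): Schur data of the banded first-order matrix `t`, section matrix
eigenpairs `(x_n, c_n)` with `x_n ∈ [a, e]`, normalisation and graph bound ⇒ a bounded `T` with matrix
`t`, `‖T‖ ≤ √(R₀C₀)`, and `λ ∈ [a, e]`, `‖v‖ = 1` solving the eigen-equation in coordinates with all
weighted moments of the coefficients finite. -/
theorem exists_smooth_eigenvector_Icc_of_sections [DecidableEq ι]
    (ℓ : ι → ℝ) (x₀ : ℝ) (d : lp (fun _ : ι => 𝕜) ⊤) (hd : ∀ i, d i * ((x₀ : 𝕜) - (ℓ i : 𝕜)) = 1)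
    (hd0 : Tendsto (fun i => ‖d i‖) cofinite (𝓝 0))
    (t : ι → ι → 𝕜) {R₀ C₀ : ℝ} (hrow : ∀ i, Summable fun j => ‖t i j‖)
    (hR : ∀ i, ∑' j, ‖t i j‖ ≤ R₀) (hcol : ∀ j, Summable fun i => ‖t i j‖)
    (hC₀ : ∀ j, ∑' i, ‖t i j‖ ≤ C₀) (hR0 : 0 ≤ R₀) (hC0 : 0 ≤ C₀) (hq : R₀ * C₀ < 1)
    (nbr : ι → Finset ι) (hsymm : ∀ i j, j ∈ nbr i ↔ i ∈ nbr j) {W : ℕ}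
    (hW : ∀ i, (nbr i).card ≤ W) (ht0 : ∀ i j, j ∉ nbr i → t i j = 0)
    (wgt : ι → ℝ) (hw0 : ∀ i, 0 ≤ wgt i) (hwℓ : ∀ i, wgt i ^ 2 ≤ 1 + |ℓ i|) {K : ℝ} (hK : 0 ≤ K)
    (ha : ∀ i j, j ∈ nbr i → ‖t i j * ((x₀ : 𝕜) - (ℓ j : 𝕜))‖ ≤ K * wgt j)
    {L : ℝ} (hLnn : 0 ≤ L) (hL : ∀ i j, j ∈ nbr i → wgt i ≤ L * wgt j)
    {M : ℝ} (hM : ∀ i, ‖d i‖ * wgt i ≤ M)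
    (F : ℕ → Finset ι) (hF : Monotone F) (hFex : ∀ i, ∃ n, i ∈ F n)
    (c : ℕ → ι → 𝕜) (xs : ℕ → ℝ) {a e : ℝ} (hxs : ∀ n, xs n ∈ Set.Icc a e)
    (heig : ∀ n, ∀ i ∈ F n, (ℓ i : 𝕜) * c n i +
      ∑ j ∈ F n, (t i j * ((x₀ : 𝕜) - (ℓ j : 𝕜))) * c n j = (xs n : 𝕜) * c n i)
    (hnorm : ∀ n, ∑ j ∈ F n, ‖c n j‖ ^ 2 = 1) {C : ℝ} (hCnn : 0 ≤ C)
    (hgraph : ∀ n, ∑ j ∈ F n, ‖((x₀ : 𝕜) - (ℓ j : 𝕜)) * c n j‖ ^ 2 ≤ C ^ 2) :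
    ∃ T : H →L[𝕜] H, (∀ i j, ⟪b i, T (b j)⟫_𝕜 = t i j) ∧ ‖T‖ ≤ Real.sqrt (R₀ * C₀) ∧
      ∃ lam ∈ Set.Icc a e, ∃ v : H, ‖v‖ = 1 ∧
        (∀ i, (ℓ i : 𝕜) * ⟪b i, v⟫_𝕜 +
            ∑ j ∈ nbr i, (t i j * ((x₀ : 𝕜) - (ℓ j : 𝕜))) * ⟪b j, v⟫_𝕜 = (lam : 𝕜) * ⟪b i, v⟫_𝕜) ∧
        ∀ s : ℕ, Summable fun i => wgt i ^ (2 * s) * ‖⟪b i, v⟫_𝕜‖ ^ 2 := by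
  -- build `T` by the Schur test
  obtain ⟨T, -, -, hTt, hTn, -⟩ :=
    Literature.Analysis.OperatorTheory.HilbertBasisSchurTest.exists_clm_of_schur_bound b t hrow hR
      hcol hC₀ hR0 hC0
  have hT1 : ‖T‖ < 1 := by
    refine lt_of_le_of_lt hTn ?_
    rw [show (1 : ℝ) = Real.sqrt 1 from Real.sqrt_one.symm]
    exact Real.sqrt_lt_sqrt (mul_nonneg hR0 hC0) hq
  -- Galerkin data from the section eigenpairs
  set u : ℕ → H := fun n => ∑ j ∈ F n, (((x₀ : 𝕜) - (ℓ j : 𝕜)) * c n j) • b j with hu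
  have heig' : ∀ n, ∀ i ∈ F n, (ℓ i : 𝕜) * c n i +
      ∑ j ∈ F n, (⟪b i, T (b j)⟫_𝕜 * ((x₀ : 𝕜) - (ℓ j : 𝕜))) * c n j = (xs n : 𝕜) * c n i := by
    intro n i hi; simp_rw [hTt]; exact heig n i hi
  have hdat := fun n => SkewCutGalerkinSections.galerkin_datum_of_section_eigenpair b ℓ x₀ d hd T
    (F n) (c n) (xs n : 𝕜) (heig' n)
  have hv1 : ∀ n, ‖b.diagonalCLM d (u n)‖ = 1 := fun n => by
    rw [hu, (hdat n).2.1]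
    have h := SkewCutGalerkinSections.norm_sq_sum_smul_basis b (F n) (c n)
    rw [hnorm n] at h
    have h0 : 0 ≤ ‖∑ j ∈ F n, c n j • b j‖ := norm_nonneg _
    nlinarith [h, h0]
  have hCn : ∀ n, ‖u n‖ ≤ C := fun n => by
    have h := SkewCutGalerkinSections.norm_sq_sum_smul_basis b (F n)
      (fun j => ((x₀ : 𝕜) - (ℓ j : 𝕜)) * c n j)
    have h2 : ‖u n‖ ^ 2 ≤ C ^ 2 := by rw [hu, h]; exact hgraph n
    exact (pow_le_pow_iff_left₀ (norm_nonneg _) hCnn two_ne_zero).mp h2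
  -- the remaining inputs of the master theorem, in terms of `T`
  have ht0' : ∀ i j, j ∉ nbr i → ⟪b i, T (b j)⟫_𝕜 = 0 := fun i j hj => by rw [hTt, ht0 i j hj]
  have ha' : ∀ i j, j ∈ nbr i → ‖⟪b i, T (b j)⟫_𝕜 * ((x₀ : 𝕜) - (ℓ j : 𝕜))‖ ≤ K * wgt j :=
    fun i j hj => by rw [hTt]; exact ha i j hj
  have hF' : Monotone fun n => ((F n : Set ι)) := fun m n hmn => Finset.coe_subset.2 (hF hmn)
  have hFex' : ∀ i, ∃ n, i ∈ (F n : Set ι) := fun i => by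
    obtain ⟨n, hn⟩ := hFex i; exact ⟨n, Finset.mem_coe.2 hn⟩
  obtain ⟨lam, hlam, v, hv1', heigv, hreg⟩ :=
    exists_smooth_eigenvector_Icc b ℓ x₀ d hd hd0 T hT1 nbr hsymm hW ht0' wgt
      hw0 hwℓ hK ha' hLnn hL hM (fun n => (F n : Set ι)) hF' hFex' u (fun n => (hdat n).1) hv1 hCn
      xs hxs (fun n => (hdat n).2.2)
  refine ⟨T, hTt, hTn, lam, hlam, v, hv1', fun i => ?_, hreg⟩
  have h := heigv i
  simp_rw [hTt] at h
  exact h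

end Summit.NavierStokesRegularity.FluidComputer.SkewCutGalerkinFromSectionsIcc

end
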